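import Literature.Topology.FourManifolds.AndrewsCurtisCertificate
import Literature.Topology.FourManifolds.CircleSurgery
import Mathlib.Algebra.Group.Commutator
import HarnessLib

/-!
# Gompf's Figure 36: the trivial-group presentations `⟨x, y ∣ α, β_m⟩` of the Cappell–Shaneson spheres of `A_m` (Gompf 1991, §6)

A reproduction record.  In §6 ("Other Cappell–Shaneson spheres") of *Killing the Akbulut–Kirby
4-sphere* Gompf considers, for each integer `m`, the Cappell–Shaneson matrix
`A_m = [[0,1,0],[0,1,1],[1,0,m+1]]` (the tree's
`Literature.Topology.FourManifolds.cappellShanesonMatrix m`) and the pair of homotopy 4-spheres it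
determines.  For one framing the sphere "turns out to be standard" (Aitchison–Rubinstein); for the
other, "a Gluck construction on a knot in S⁴", Gompf gives a handle presentation WITHOUT 3-handles
(his Fig. 36): "It follows that Fig. 36 does indeed represent a homotopy 4-sphere. (To see that it
is simply connected, turn the handlebody upside-down to obtain a new handle structure without
1-handles.) When `m = 0`, the picture may be transformed directly into the Akbulut-Kirby example,
although this computation is quite difficult.  The presentation of the trivial group associated to
Fig. 36 is `⟨x, y ∣ α, β⟩` where `α = [y,x]y[y,x⁻¹]` and `β = x⁻ᵐ[y,x]yx⁻¹y⁻¹xᵐ[y⁻¹,x⁻¹]y`. (Here,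
`[a, b] = aba⁻¹b⁻¹`.)" (p. 114–115), and, after exhibiting a word conjugate to `y⁻¹` that proves
triviality: "The author knows of no simpler algebraic proof of triviality, or of any reasonable
presentation to which the given one is Andrews-Curtis equivalent. For `m ≠ 0`, it is unknown if
these manifolds are standard" (p. 115).

What is recorded here: the balanced presentations `gompfFigure36 m` as data over the tree's
`BalancedPresentation` (Mathlib's scoped `⁅a, b⁆ = a * b * a⁻¹ * b⁻¹`, `open scoped commutatorElement`, is Gompf's convention), their letter
spellings for `m = 0, 1, -1` checked against the closed forms by the kernel, Gompf's algebraic proof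
that the group is trivial (p. 115: an explicit product of conjugates of `α^{±1}, β^{±1}` conjugate to
`y⁻¹`) replayed by the kernel for `m = 0, 1, -1` (`presentsTrivialGroup_gompfFigure36_zero` …), and the NAME of the open
question Gompf raises — `GompfFigure36ACTrivial m : Prop`, the Andrews–Curtis triviality of the
presentation — with no claim either way.  The later theorems that all these MANIFOLDS are
diffeomorphic to `S⁴` (Akbulut 2010; Gompf 2010, both framings of every `A_m`) live in
`Literature/Barriers/SmoothPoincare4/CappellShanesonFamilyStandard.lean`; they say nothing about
`GompfFigure36ACTrivial`, which is open in print for every `m` (an Andrews–Curtis trivialisation of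
the presentation is not implied by, and would not by itself re-prove, standardness of the sphere).

## Sources

* R. E. Gompf, *Killing the Akbulut–Kirby 4-sphere, with relevance to the Andrews–Curtis and
  Schoenflies problems*, Topology 30 (1991) 97–115, §6, pp. 114–115, Fig. 36. [Gompf1991Killing]
* J. J. Andrews, M. L. Curtis, Proc. AMS 16 (1965) 192–195 (the moves). [AndrewsCurtis1965]
-/

namespace Literature.Barriers.SmoothPoincare4

open Literature.Topology.FourManifolds
open scoped commutatorElement

/-! ### The presentations -/

/-- Gompf's first relator `α = [y,x]·y·[y,x⁻¹]` on the generators `x = x₀`, `y = x₁`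
(`[a,b] = aba⁻¹b⁻¹`); as a word, `y x y⁻¹ x⁻¹ · y · y x⁻¹ y⁻¹ x`.  It does not depend on `m`.
[cite: Gompf1991Killing, §6 p. 114] -/
def gompfFigure36Alpha : FreeGroup (Fin 2) :=
  ⁅FreeGroup.of (1 : Fin 2), FreeGroup.of (0 : Fin 2)⁆ * FreeGroup.of (1 : Fin 2) * ⁅FreeGroup.of (1 : Fin 2), (FreeGroup.of (0 : Fin 2))⁻¹⁆

/-- Gompf's second relator `β_m = x⁻ᵐ·[y,x]·y·x⁻¹·y⁻¹·xᵐ·[y⁻¹,x⁻¹]·y` (`[a,b] = aba⁻¹b⁻¹`), of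
length `12 + 2|m|` as a reduced word. [cite: Gompf1991Killing, §6 p. 114] -/
def gompfFigure36Beta (m : ℤ) : FreeGroup (Fin 2) :=
  (FreeGroup.of (0 : Fin 2)) ^ (-m) * ⁅FreeGroup.of (1 : Fin 2), FreeGroup.of (0 : Fin 2)⁆ * FreeGroup.of (1 : Fin 2) * (FreeGroup.of (0 : Fin 2))⁻¹ *
    (FreeGroup.of (1 : Fin 2))⁻¹ * (FreeGroup.of (0 : Fin 2)) ^ m * ⁅(FreeGroup.of (1 : Fin 2))⁻¹, (FreeGroup.of (0 : Fin 2))⁻¹⁆ * FreeGroup.of (1 : Fin 2)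

/-- **Gompf's Figure 36 presentation** `G36(m) = ⟨x, y ∣ α, β_m⟩` of the trivial group: the
presentation of the fundamental group read off the handlebody without 3-handles of Fig. 36, i.e. of
the Cappell–Shaneson homotopy sphere of `cappellShanesonMatrix m` with the framing not covered by
Aitchison–Rubinstein ("a Gluck construction on a knot in `S⁴`"); for `m = 0` "the picture may be
transformed directly into the Akbulut-Kirby example". [cite: Gompf1991Killing, §6 pp. 114–115] -/
def gompfFigure36 (m : ℤ) : BalancedPresentation 2 :=
  ![gompfFigure36Alpha, gompfFigure36Beta m]

/-- The first relator of `gompfFigure36 m` is `α`. [cite: Gompf1991Killing, §6 p. 114] -/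
@[simp] theorem gompfFigure36_apply_zero (m : ℤ) : gompfFigure36 m 0 = gompfFigure36Alpha := rfl

/-- The second relator of `gompfFigure36 m` is `β_m`. [cite: Gompf1991Killing, §6 p. 114] -/
@[simp] theorem gompfFigure36_apply_one (m : ℤ) : gompfFigure36 m 1 = gompfFigure36Beta m := rfl

/-! ### Letter spellings (for certificate tooling), checked against the closed forms -/

/-- `α` spelled as letters: `y x Y X y y X Y x` (capital = inverse), length 9. [cite: Gompf1991Killing, §6 p. 114] -/
def gompfFigure36AlphaW : List (Fin 2 × Bool) :=
  [((1 : Fin 2), true), (0, true), (1, false), (0, false), (1, true), (1, true), (0, false), (1, false), (0, true)]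

/-- `β₀` spelled as letters: `y x Y X y X Y Y X y x y`, length 12. [cite: Gompf1991Killing, §6 p. 114] -/
def gompfFigure36BetaZeroW : List (Fin 2 × Bool) :=
  [((1 : Fin 2), true), (0, true), (1, false), (0, false), (1, true), (0, false), (1, false), (1, false),
    (0, false), (1, true), (0, true), (1, true)]

/-- `β₁` spelled as letters: `X y x Y X y X Y x Y X y x y`, length 14. [cite: Gompf1991Killing, §6 p. 114] -/
def gompfFigure36BetaOneW : List (Fin 2 × Bool) :=
  [((0 : Fin 2), false), (1, true), (0, true), (1, false), (0, false), (1, true), (0, false), (1, false),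
    (0, true), (1, false), (0, false), (1, true), (0, true), (1, true)]

/-- `β₋₁` spelled as letters: `x y x Y X y X Y X Y X y x y`, length 14. [cite: Gompf1991Killing, §6 p. 114] -/
def gompfFigure36BetaNegOneW : List (Fin 2 × Bool) :=
  [((0 : Fin 2), true), (1, true), (0, true), (1, false), (0, false), (1, true), (0, false), (1, false),
    (0, false), (1, false), (0, false), (1, true), (0, true), (1, true)]

/-- The letter spelling of `G36(0)` is Gompf's presentation for `m = 0`. [cite: Gompf1991Killing, §6 p. 114] -/
theorem toPres_gompfFigure36_zero :
    ACCert.toPres (![gompfFigure36AlphaW, gompfFigure36BetaZeroW] : ACCert.WPres 2) = gompfFigure36 0 := by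
  decide +kernel

/-- The letter spelling of `G36(1)` is Gompf's presentation for `m = 1`. [cite: Gompf1991Killing, §6 p. 114] -/
theorem toPres_gompfFigure36_one :
    ACCert.toPres (![gompfFigure36AlphaW, gompfFigure36BetaOneW] : ACCert.WPres 2) = gompfFigure36 1 := by
  decide +kernel

/-- The letter spelling of `G36(-1)` is Gompf's presentation for `m = -1`. [cite: Gompf1991Killing, §6 p. 114] -/
theorem toPres_gompfFigure36_neg_one :
    ACCert.toPres (![gompfFigure36AlphaW, gompfFigure36BetaNegOneW] : ACCert.WPres 2) = gompfFigure36 (-1) := by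
  decide +kernel

/-! ### Gompf's algebraic proof of triviality (p. 115), replayed by the kernel for `m = 0, 1, -1`

Gompf: "To see directly that this is trivial, let `z` denote `[y,x][y,x⁻¹]`, and consider the word
`(x⁻¹[z,α⁻¹])ᵐ [α⁻¹, zxz⁻¹] xᵐ β (y⁻¹[x⁻¹,y⁻¹][x,y⁻¹]xyβ⁻¹(x⁻¹y⁻¹α⁻¹yx)y⁻¹x⁻¹y⁻¹[x,y]αx⁻¹yxy) x⁻¹
(x⁻¹y⁻¹xα⁻¹x⁻¹yx) y (β⁻¹x⁻ᵐzαz⁻¹xα⁻¹xᵐβx⁻¹) y⁻¹x`.  By inspection, it may be seen that this word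
becomes trivial when `α` and `β` are modded out.  But in the free group on `x` and `y`, it may be
computed that this word is conjugate to the generator `y⁻¹`."  We record the word (transcribed from
the scan; the transcription is confirmed by the computation) as an explicit product of conjugates
`∏ gᵢ rᵢ^{±1} gᵢ⁻¹` of the relators (`11 + 2|m|` factors) together with the conjugator `c_m`
(`∏ = c_m y⁻¹ c_m⁻¹`), and the second, elementary step `x = β_m⁻¹ · ∏ hⱼ y^{±1} hⱼ⁻¹` (deleting the
`y`-letters of `β_m` leaves `x⁻¹`); both identities are decided by the kernel in `FreeGroup (Fin 2)`
and assembled into `PresentsTrivialGroup`.  (The cell's Python reproduction checks the same two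
identities by free reduction for `|m| ≤ 6`; the uniform-in-`m` statement is Gompf's and is not
re-proved here.) -/

/-- A conjugate `g · (R i)^{±1} · g⁻¹` of a member of a family `R`, from letter data
`(g, i, sign)`. [folklore] -/
def conjTerm {k : ℕ} (R : Fin k → FreeGroup (Fin 2)) (d : List (Fin 2 × Bool) × Fin k × Bool) :
    FreeGroup (Fin 2) :=
  FreeGroup.mk d.1 * (if d.2.2 then R d.2.1 else (R d.2.1)⁻¹) * (FreeGroup.mk d.1)⁻¹

/-- A product of conjugates of members of `R` lies in any normal subgroup containing the `R i`.
[folklore] -/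
theorem prod_map_conjTerm_mem {k : ℕ} (R : Fin k → FreeGroup (Fin 2)) (N : Subgroup (FreeGroup (Fin 2)))
    [N.Normal] (hR : ∀ i, R i ∈ N) (L : List (List (Fin 2 × Bool) × Fin k × Bool)) :
    (L.map (conjTerm R)).prod ∈ N := by
  refine Subgroup.list_prod_mem (K := N) ?_
  intro g hg
  obtain ⟨d, -, rfl⟩ := List.mem_map.1 hg
  unfold conjTerm
  refine Subgroup.Normal.conj_mem inferInstance _ ?_ _
  split_ifs
  · exact hR _
  · exact N.inv_mem (hR _)

/-- If `c * g⁻¹ * c⁻¹ ∈ N` and `N` is normal then `g ∈ N`. [folklore] -/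
theorem mem_of_conj_inv_mem (N : Subgroup (FreeGroup (Fin 2))) [hN : N.Normal] (c g : FreeGroup (Fin 2))
    (h : c * g⁻¹ * c⁻¹ ∈ N) : g ∈ N := by
  have h' := hN.conj_mem _ h c⁻¹
  simp only [inv_inv, ← mul_assoc, inv_mul_cancel, one_mul, inv_mul_cancel_right] at h'
  exact (Subgroup.inv_mem_iff N).1 h'

/-- A balanced presentation on two generators presents the trivial group as soon as both generators
lie in the normal closure of the relators. [folklore] -/
theorem presentsTrivialGroup_of_of_mem (P : BalancedPresentation 2)
    (h0 : FreeGroup.of (0 : Fin 2) ∈ Subgroup.normalClosure (Set.range P))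
    (h1 : FreeGroup.of (1 : Fin 2) ∈ Subgroup.normalClosure (Set.range P)) : P.PresentsTrivialGroup := by
  rw [BalancedPresentation.presentsTrivialGroup_iff_normalClosure_eq_top, eq_top_iff, ← FreeGroup.closure_range_of,
    Subgroup.closure_le]
  rintro _ ⟨i, rfl⟩
  fin_cases i
  · exact h0
  · exact h1

/-- Gompf's word for `m = 0` as conjugate data over `gompfFigure36 0` (`11` factors; index `0 = α`,
`1 = β`). [cite: Gompf1991Killing, §6 p. 115] -/
def gompfWordZeroData : List (List (Fin 2 × Bool) × Fin 2 × Bool) :=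
  [([], 0, false),
    ([(1, true), (0, true), (1, false), (0, false), (1, true), (0, false), (1, false), (0, true), (1, true), (0, true), (1, false), (0, true), (1, true), (0, false), (1, false)], 0, true),
    ([], 1, true),
    ([(1, false), (0, false), (1, false), (0, true), (1, true), (0, true), (1, false), (0, false), (1, true), (0, true), (1, true)], 1, false),
    ([(1, false), (0, false), (1, false), (0, true), (1, true), (0, true), (1, false), (0, false), (1, true), (0, true), (1, true), (0, false), (1, false)], 0, false),
    ([(1, false), (0, false), (1, false), (0, true)], 0, true),
    ([(0, false), (0, false), (1, false), (0, true)], 0, false),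
    ([(0, false), (1, true)], 1, false),
    ([(0, false), (1, true), (1, true), (0, true), (1, false), (0, false), (1, true), (0, false), (1, false), (0, true)], 0, true),
    ([(0, false), (1, true), (0, true)], 0, false),
    ([(0, false), (1, true), (0, true)], 1, true)]

/-- The conjugator `c` with `∏ (Gompf's word) = c y⁻¹ c⁻¹` for `m = 0` (length 14). [cite: Gompf1991Killing, §6 p. 115] -/
def gompfWordZeroConj : List (Fin 2 × Bool) :=
  [(0, false), (1, true), (0, true), (1, false), (0, false), (1, false), (0, true), (1, true), (0, true), (1, true), (0, false), (1, false), (1, false), (0, false)]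

/-- Conjugate data expressing `β · x` as a product of conjugates of `y` (`m = 0`). [folklore] -/
def gompfBetaZeroYData : List (List (Fin 2 × Bool) × Fin 1 × Bool) :=
  [([], 0, true),
    ([(0, true)], 0, false),
    ([], 0, true),
    ([(0, false)], 0, false),
    ([(0, false)], 0, false),
    ([(0, false), (0, false)], 0, true),
    ([(0, false)], 0, true)]

/-- **Gompf's identity, `m = 0`**: his product of conjugates of `α^{±1}, β^{±1}` is conjugate to `y⁻¹`
in `F(x, y)` (kernel computation). [cite: Gompf1991Killing, §6 p. 115] -/
theorem prod_gompfWordZero :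
    (gompfWordZeroData.map (conjTerm (gompfFigure36 0))).prod =
      FreeGroup.mk gompfWordZeroConj * (FreeGroup.of (1 : Fin 2))⁻¹ * (FreeGroup.mk gompfWordZeroConj)⁻¹ := by
  decide +kernel

/-- `β⁻¹ · ∏ hⱼ y^{±1} hⱼ⁻¹ = x` for `m = 0` (kernel computation). [folklore] -/
theorem beta_inv_mul_prod_gompfBetaZeroY :
    (gompfFigure36Beta 0)⁻¹ * (gompfBetaZeroYData.map (conjTerm ![FreeGroup.of (1 : Fin 2)])).prod =
      FreeGroup.of (0 : Fin 2) := by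
  decide +kernel

/-- **`G36(0)` presents the trivial group**, by Gompf's algebraic argument replayed in the kernel.
[cite: Gompf1991Killing, §6 p. 115] -/
theorem presentsTrivialGroup_gompfFigure36_zero : (gompfFigure36 0).PresentsTrivialGroup := by
  have hR : ∀ i, gompfFigure36 0 i ∈ Subgroup.normalClosure (Set.range (gompfFigure36 0)) :=
    fun i ↦ Subgroup.subset_normalClosure ⟨i, rfl⟩
  have hy : FreeGroup.of (1 : Fin 2) ∈ Subgroup.normalClosure (Set.range (gompfFigure36 0)) := by
    refine mem_of_conj_inv_mem _ (FreeGroup.mk gompfWordZeroConj) _ ?_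
    rw [← prod_gompfWordZero]
    exact prod_map_conjTerm_mem _ _ hR _
  have hx : FreeGroup.of (0 : Fin 2) ∈ Subgroup.normalClosure (Set.range (gompfFigure36 0)) := by
    rw [← beta_inv_mul_prod_gompfBetaZeroY]
    refine Subgroup.mul_mem _ (Subgroup.inv_mem _ ?_) (prod_map_conjTerm_mem _ _ ?_ _)
    · simpa using hR 1
    · intro i; fin_cases i; simpa using hy
  exact presentsTrivialGroup_of_of_mem _ hx hy

/-- Gompf's word for `m = 1` as conjugate data over `gompfFigure36 1` (`13` factors; index `0 = α`,
`1 = β`). [cite: Gompf1991Killing, §6 p. 115] -/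
def gompfWordOneData : List (List (Fin 2 × Bool) × Fin 2 × Bool) :=
  [([(0, false), (1, true), (0, true), (1, false), (0, false), (1, true), (0, false), (1, false), (0, true)], 0, false),
    ([(0, false)], 0, true),
    ([(0, false)], 0, false),
    ([(0, false), (1, true), (0, true), (1, false), (0, false), (1, true), (0, false), (1, false), (0, true), (1, true), (0, true), (1, false), (0, true), (1, true), (0, false), (1, false)], 0, true),
    ([], 1, true),
    ([(1, false), (0, false), (1, false), (0, true), (1, true), (0, true), (1, false), (0, false), (1, true), (0, true), (1, true)], 1, false),
    ([(1, false), (0, false), (1, false), (0, true), (1, true), (0, true), (1, false), (0, false), (1, true), (0, true), (1, true), (0, false), (1, false)], 0, false),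
    ([(1, false), (0, false), (1, false), (0, true)], 0, true),
    ([(0, false), (0, false), (1, false), (0, true)], 0, false),
    ([(0, false), (1, true)], 1, false),
    ([(0, false), (1, true), (0, false), (1, true), (0, true), (1, false), (0, false), (1, true), (0, false), (1, false), (0, true)], 0, true),
    ([(0, false), (1, true)], 0, false),
    ([(0, false), (1, true), (0, true)], 1, true)]

/-- The conjugator `c` with `∏ (Gompf's word) = c y⁻¹ c⁻¹` for `m = 1` (length 14). [cite: Gompf1991Killing, §6 p. 115] -/
def gompfWordOneConj : List (Fin 2 × Bool) :=
  [(0, false), (1, true), (0, true), (1, false), (0, false), (1, false), (0, true), (1, true), (1, true), (0, false), (1, false), (0, true), (1, false), (0, false)]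

/-- Conjugate data expressing `β · x` as a product of conjugates of `y` (`m = 1`). [folklore] -/
def gompfBetaOneYData : List (List (Fin 2 × Bool) × Fin 1 × Bool) :=
  [([(0, false)], 0, true),
    ([], 0, false),
    ([(0, false)], 0, true),
    ([(0, false), (0, false)], 0, false),
    ([(0, false)], 0, false),
    ([(0, false), (0, false)], 0, true),
    ([(0, false)], 0, true)]

/-- **Gompf's identity, `m = 1`**: his product of conjugates of `α^{±1}, β^{±1}` is conjugate to `y⁻¹`
in `F(x, y)` (kernel computation). [cite: Gompf1991Killing, §6 p. 115] -/
theorem prod_gompfWordOne :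
    (gompfWordOneData.map (conjTerm (gompfFigure36 1))).prod =
      FreeGroup.mk gompfWordOneConj * (FreeGroup.of (1 : Fin 2))⁻¹ * (FreeGroup.mk gompfWordOneConj)⁻¹ := by
  decide +kernel

/-- `β⁻¹ · ∏ hⱼ y^{±1} hⱼ⁻¹ = x` for `m = 1` (kernel computation). [folklore] -/
theorem beta_inv_mul_prod_gompfBetaOneY :
    (gompfFigure36Beta 1)⁻¹ * (gompfBetaOneYData.map (conjTerm ![FreeGroup.of (1 : Fin 2)])).prod =
      FreeGroup.of (0 : Fin 2) := by
  decide +kernel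

/-- **`G36(1)` presents the trivial group**, by Gompf's algebraic argument replayed in the kernel.
[cite: Gompf1991Killing, §6 p. 115] -/
theorem presentsTrivialGroup_gompfFigure36_one : (gompfFigure36 1).PresentsTrivialGroup := by
  have hR : ∀ i, gompfFigure36 1 i ∈ Subgroup.normalClosure (Set.range (gompfFigure36 1)) :=
    fun i ↦ Subgroup.subset_normalClosure ⟨i, rfl⟩
  have hy : FreeGroup.of (1 : Fin 2) ∈ Subgroup.normalClosure (Set.range (gompfFigure36 1)) := by
    refine mem_of_conj_inv_mem _ (FreeGroup.mk gompfWordOneConj) _ ?_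
    rw [← prod_gompfWordOne]
    exact prod_map_conjTerm_mem _ _ hR _
  have hx : FreeGroup.of (0 : Fin 2) ∈ Subgroup.normalClosure (Set.range (gompfFigure36 1)) := by
    rw [← beta_inv_mul_prod_gompfBetaOneY]
    refine Subgroup.mul_mem _ (Subgroup.inv_mem _ ?_) (prod_map_conjTerm_mem _ _ ?_ _)
    · simpa using hR 1
    · intro i; fin_cases i; simpa using hy
  exact presentsTrivialGroup_of_of_mem _ hx hy

/-- Gompf's word for `m = -1` as conjugate data over `gompfFigure36 -1` (`13` factors; index `0 = α`,
`1 = β`). [cite: Gompf1991Killing, §6 p. 115] -/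
def gompfWordNegOneData : List (List (Fin 2 × Bool) × Fin 2 × Bool) :=
  [([], 0, false),
    ([(1, true), (0, true), (1, false), (0, false), (1, true), (0, false), (1, false), (0, true)], 0, true),
    ([(0, true)], 0, false),
    ([(0, true), (1, true), (0, true), (1, false), (0, false), (1, true), (0, false), (1, false), (0, true), (1, true), (0, true), (1, false), (0, true), (1, true), (0, false), (1, false)], 0, true),
    ([], 1, true),
    ([(1, false), (0, false), (1, false), (0, true), (1, true), (0, true), (1, false), (0, false), (1, true), (0, true), (1, true)], 1, false),
    ([(1, false), (0, false), (1, false), (0, true), (1, true), (0, true), (1, false), (0, false), (1, true), (0, true), (1, true), (0, false), (1, false)], 0, false),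
    ([(1, false), (0, false), (1, false), (0, true)], 0, true),
    ([(0, false), (0, false), (1, false), (0, true)], 0, false),
    ([(0, false), (1, true)], 1, false),
    ([(0, false), (1, true), (0, true), (1, true), (0, true), (1, false), (0, false), (1, true), (0, false), (1, false), (0, true)], 0, true),
    ([(0, false), (1, true), (0, true), (0, true)], 0, false),
    ([(0, false), (1, true), (0, true)], 1, true)]

/-- The conjugator `c` with `∏ (Gompf's word) = c y⁻¹ c⁻¹` for `m = -1` (length 16). [cite: Gompf1991Killing, §6 p. 115] -/
def gompfWordNegOneConj : List (Fin 2 × Bool) :=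
  [(0, false), (1, true), (0, true), (1, false), (0, false), (1, false), (0, true), (1, true), (0, true), (0, true), (1, true), (0, false), (1, false), (0, false), (1, false), (0, false)]

/-- Conjugate data expressing `β · x` as a product of conjugates of `y` (`m = -1`). [folklore] -/
def gompfBetaNegOneYData : List (List (Fin 2 × Bool) × Fin 1 × Bool) :=
  [([(0, true)], 0, true),
    ([(0, true), (0, true)], 0, false),
    ([(0, true)], 0, true),
    ([], 0, false),
    ([(0, false)], 0, false),
    ([(0, false), (0, false)], 0, true),
    ([(0, false)], 0, true)]

/-- **Gompf's identity, `m = -1`**: his product of conjugates of `α^{±1}, β^{±1}` is conjugate to `y⁻¹`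
in `F(x, y)` (kernel computation). [cite: Gompf1991Killing, §6 p. 115] -/
theorem prod_gompfWordNegOne :
    (gompfWordNegOneData.map (conjTerm (gompfFigure36 (-1)))).prod =
      FreeGroup.mk gompfWordNegOneConj * (FreeGroup.of (1 : Fin 2))⁻¹ * (FreeGroup.mk gompfWordNegOneConj)⁻¹ := by
  decide +kernel

/-- `β⁻¹ · ∏ hⱼ y^{±1} hⱼ⁻¹ = x` for `m = -1` (kernel computation). [folklore] -/
theorem beta_inv_mul_prod_gompfBetaNegOneY :
    (gompfFigure36Beta (-1))⁻¹ * (gompfBetaNegOneYData.map (conjTerm ![FreeGroup.of (1 : Fin 2)])).prod =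
      FreeGroup.of (0 : Fin 2) := by
  decide +kernel

/-- **`G36(-1)` presents the trivial group**, by Gompf's algebraic argument replayed in the kernel.
[cite: Gompf1991Killing, §6 p. 115] -/
theorem presentsTrivialGroup_gompfFigure36_neg_one : (gompfFigure36 (-1)).PresentsTrivialGroup := by
  have hR : ∀ i, gompfFigure36 (-1) i ∈ Subgroup.normalClosure (Set.range (gompfFigure36 (-1))) :=
    fun i ↦ Subgroup.subset_normalClosure ⟨i, rfl⟩
  have hy : FreeGroup.of (1 : Fin 2) ∈ Subgroup.normalClosure (Set.range (gompfFigure36 (-1))) := by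
    refine mem_of_conj_inv_mem _ (FreeGroup.mk gompfWordNegOneConj) _ ?_
    rw [← prod_gompfWordNegOne]
    exact prod_map_conjTerm_mem _ _ hR _
  have hx : FreeGroup.of (0 : Fin 2) ∈ Subgroup.normalClosure (Set.range (gompfFigure36 (-1))) := by
    rw [← beta_inv_mul_prod_gompfBetaNegOneY]
    refine Subgroup.mul_mem _ (Subgroup.inv_mem _ ?_) (prod_map_conjTerm_mem _ _ ?_ _)
    · simpa using hR 1
    · intro i; fin_cases i; simpa using hy
  exact presentsTrivialGroup_of_of_mem _ hx hy

/-! ### The open question (NAMED, no claim) -/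

/-- **Gompf's question (open in print for every `m`)**: is the Figure 36 presentation `G36(m)`
Andrews–Curtis trivial?  "The author knows of no simpler algebraic proof of triviality, or of any
reasonable presentation to which the given one is Andrews-Curtis equivalent."  Recorded as a NAME
only; users who need it take `(h : GompfFigure36ACTrivial m)` or prove / refute instances by explicit
certificates. [cite: Gompf1991Killing, §6 p. 115] -/
def GompfFigure36ACTrivial (m : ℤ) : Prop :=
  IsAndrewsCurtisEquivalent (gompfFigure36 m) (BalancedPresentation.trivial 2)



end Literature.Barriers.SmoothPoincare4
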